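/-
Copyright (c) 2026 the pub-hodgecm-mathlib formalisation cell (harness21).  Prover seat hodgecm-mathlib-K2E3-p21 (g8), Track B «K2-LIT» ∕ h413,
line `K2_E3_EllipticInputs`, unit U12 «Characters», PART «RANK», leaf (qs2-ps) `sig_K2E3CharLocIntNearPrincipalSeriesQuasiSplitTwo`, road «van Dijk₂».
(ASM₂) FILE B1: the `W`-reflection of the parameter torus `E_vˣ`, the fibre dichotomy on `T₂`, the class functions of the hyperbolic set (★ CLS₂ discharged) and the
WEIGHTED class functions `dg₂⁻¹ · N_ψ` of `U(Φ₂)(L⁺_v)`.  2026-09-04.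
-/
import Summits.HodgeConjecture.HodgeConjecture.Theorems.K2E3QuasiSplitTwoWeylDiscrJunction     -- ★ (this seat) A2 junction `dgFormula₂_coe_torus_eq_vanDijkWeight₂_re`, `dgFormula₂_conj`; brings ★ A1 `K2E3QuasiSplitTwoVanDijkCore`, ★ D115
import Summits.HodgeConjecture.HodgeConjecture.Theorems.K2E3QuasiSplitTwoWeylDensity           -- ★ p860877 (K2E3-p14 g8) D118: `continuous_dgFormula₂`; brings ★ KIT₂, ★ W2-1 (`exists_mem_torusU_isRegularElt_two_cm`, `isClosed_cmBorelTriple_M_two`), ★ WeylHyp{Fibre,Torsor,CM,Measure}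
import Summits.HodgeConjecture.HodgeConjecture.Theorems.K2E3U11WeylDiscrLocInt                  -- ★ p860826 (K2E3-p27 g0) D117 (HCD₂): `locallyIntegrable_dgFormula₂_inv`
import Summits.HodgeConjecture.HodgeConjecture.Theorems.K2E3HyperbolicClassFunOfTorusTwo       -- ★ p860719 (K2E3-p25 g2) D119 (CLS₂-fun): `exists_hyperbolicClassFun_two` (hypothesis-first on the fibre dichotomy and the regular centraliser)
import Summits.HodgeConjecture.HodgeConjecture.Theorems.F0P3cStCharTSUpTrU2Norm                 -- ★ JAC-LOC₂ (B4): `mem_normalizer_torusU_two_iff_mem_or_mul_weyl_mem` (`N(T₂) = T₂ ⊔ T₂·w₀`), `forall_mem_torusU_mul_comm`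
import Summits.HodgeConjecture.HodgeConjecture.Theorems.F0P3cStCharTSTorusRay                    -- ★ (LH6-p01) `secondCountableTopology_units_localRing` (`E_vˣ` second countable; N-free)
import HarnessLib

/-!
# K2_E3 road (h413 = stmt-HodgeConjecture-24833), PART «RANK», leaf (qs2-ps) «van Dijk₂» — (ASM₂) FILE B1:
# WEIGHTED CLASS FUNCTIONS `dg₂⁻¹ · N_ψ` ON THE HYPERBOLIC SET OF `G₂ = U(Φ₂)(L⁺_v)`; THE `W`-REFLECTION OF THE PARAMETER TORUS
# [Rogawski1990, §12.5 p. 182; §4.9 (4.9.4) p. 56; §12.2 p. 173] [HarishChandra1970, Part VII §1 Thm. 15; Lemma 42]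

Cell `pub/hodgecm-mathlib` (D-0151), Track B (21-frontier RULING «PUSH BOTH» 2026-09-03), `--supports stmt-HodgeConjecture-24833 --as helper` (count-neutral);
THEOREMS ONLY — no `def`, no instance, no notation, no named fact, no `sorry`; ★-only imports.  Seat K2E3-p21 (g8), (ASM₂)+head of (qs2-ps) BY BOOK (dealer
K2E3-plan (g4) 2026-09-04T13:33:49Z).  The N = 2 twins of ★ `F0P3cStCharTSTorusRay` §2 (the reflection `ω` is measure preserving), ★ `F0P3cStCharTSWeylHypTorsor.fibre_dichotomy`
and ★ `K2E3CharLocIntPrincipalSeriesThree.exists_weightedClassFun` §3 — the last inputs of the assembly FILE B2 `K2E3CharLocIntNearPrincipalSeriesQuasiSplitTwo`.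
`G₂ = ↥(unitaryGroupOfForm (conjLocal L c v) (cmLocalForm L 2 v))`, `T₂ = (cmBorelTriple L 2 v).M`, `w₀ ∈ G₂` the element with matrix `Φ₂`, `ʷt = w₀ t w₀⁻¹`, `Ω₂ = hyperbolicSet₂ L v`.
* §1 **the reflection `ω(α) = σ(α)⁻¹` of `E_vˣ = (LocalRing L v)ˣ`** (print's `w₀` on the parameter torus, ★ A1 `torusChart₂_reflect`): continuous involutive automorphism,
  a measurable embedding, and **measure preserving for EVERY Haar measure** (Haar uniqueness: `μ.map ω = c • μ`, `ω² = 1 ⇒ c² = 1`), every finite `v`.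
* §2 **the fibre dichotomy on `T₂`** (`v` non-split): regular `t, t′ ∈ T₂` conjugate in `G₂` ⇒ `t′ = t ∨ t′ = ʷt` (★ Torsor `conj_eq_conj_iff` + ★ (B4) `N(T₂) = T₂ ⊔ T₂·w₀`);
  with ★ (A1) this discharges the two letters of ★ CLS₂ `exists_hyperbolicClassFun_two`: **`exists_hyperbolicClassFun₂`** — for `ψ : T₂ → ℂ` continuous and `W`-symmetric there
  is a measurable class function `N_ψ` on `G₂`, `= ψ` on `T₂^{reg}`, `0` off `Ω₂`, bounded on compacts.
* §3 **`exists_weightedClassFun₂`** — `α_ψ = dg₂⁻¹ · N_ψ` is measurable, LOCALLY INTEGRABLE for every Haar measure (★ HCD₂ `locallyIntegrable_dgFormula₂_inv`, `N_ψ` bounded on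
  compacts), a class function on `Ω₂`, `0` off `Ω₂`, and `= (Re Δ₂(t))⁻¹ · ψ(t)` at regular `t ∈ T₂` (★ A2 junction `dg₂ = Re Δ₂` on `T₂`).
With `ψ = χ + χ∘ʷ` this `α_ψ`, times the calibration constant `c₀∕c_T`, IS the character `Θ_χ` of `i_G(χ)` (FILE B2).

HONEST LABEL: HC_CM is proved only modulo the 7 printed citations (2 remaining named inputs: hLiu418 = stmt-HodgeConjecture-24832, h413 = stmt-HodgeConjecture-24833)
until rung 0 closes; count-neutral helper toward the OPEN leaf (qs2-ps); it closes nothing by itself.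

## References
* [Rogawski1990] J. D. Rogawski, *Automorphic Representations of Unitary Groups in Three Variables*, Ann. of Math. Stud. 123 (1990): §12.5 p. 182 (Weyl integration, `D_G`,
  the regular hyperbolic set); §4.9 (4.9.4) p. 56; §12.2 p. 173; §12.7 L. 12.7.2 (proof) p. 193.
* [HarishChandra1970] Harish-Chandra (notes by G. van Dijk), *Harmonic Analysis on Reductive p-adic Groups*, LNM 162 (1970), Part VII §1 Thm. 15 (`|D|^{−1∕2} ∈ L¹_loc`), Lemma 42.
* [vanDijk1972] G. van Dijk, *Computation of certain induced characters of 𝔭-adic groups*, Math. Ann. 199 (1972), §2, Thm. p. 237.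
-/

set_option autoImplicit false
-- the mandated namespace has the single-problem summit's repeated segment (`HodgeConjecture.HodgeConjecture`)
set_option linter.dupNamespace false

noncomputable section

open MeasureTheory Measure Set Filter Topology Function NumberField IsDedekindDomain Matrix
open Literature.MeasureTheory.Group
open Literature.NumberTheory.Automorphic Literature.NumberTheory.Automorphic.UnitaryGroup Literature.NumberTheory.Rogawski1990
open Literature.NumberTheory.GaloisRepresentations Literature.NumberTheory.GaloisRepresentations.IsNonarchimedeanLocalField
open Summit.HodgeConjecture.HodgeConjecture.Cruxes.H413
open Summit.HodgeConjecture.HodgeConjecture.Cruxes.H413.K2E3QuasiSplitTwoTorusDefs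
open Summit.HodgeConjecture.HodgeConjecture.Cruxes.H413.K2E3QuasiSplitTwoVanDijkCore
open Summit.HodgeConjecture.HodgeConjecture.Cruxes.H413.K2E3QuasiSplitTwoWeylDiscrJunction
open scoped ENNReal NNReal MatrixGroups

namespace Summit.HodgeConjecture.HodgeConjecture.Cruxes.H413.K2E3QuasiSplitTwoWeightedClassFun

variable (L : Type) [Field L] [NumberField L] [IsCMField L] (v : HeightOneSpectrum (𝓞 ↥(maximalRealSubfield L)))

/-! ## §1 The `W`-reflection `ω(α) = σ(α)⁻¹` of the parameter torus `E_vˣ` (every finite `v`) -/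

/-- `ω` is continuous (★ `continuous_conjLocal`; inversion is continuous on `E_vˣ`). [cite: Rogawski1990, §12.2 p. 173] -/
theorem continuous_reflect₂ :
    Continuous (fun a : (LocalRing L v)ˣ => (Units.map ((conjLocal L (IsCMField.complexConj L) v : LocalRing L v →+* LocalRing L v) : LocalRing L v →* LocalRing L v) a)⁻¹) :=
  (Continuous.units_map _ (continuous_conjLocal L (IsCMField.complexConj L) v)).inv

/-- **`ω` is an involution**: `σ(σ(α)⁻¹)⁻¹ = σ(σ(α)) = α` (★ `conjLocal_conjLocal_cm`). [cite: Rogawski1990, §12.2 p. 173] -/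
theorem reflect₂_reflect₂ (a : (LocalRing L v)ˣ) :
    (Units.map ((conjLocal L (IsCMField.complexConj L) v : LocalRing L v →+* LocalRing L v) : LocalRing L v →* LocalRing L v)
      ((Units.map ((conjLocal L (IsCMField.complexConj L) v : LocalRing L v →+* LocalRing L v) : LocalRing L v →* LocalRing L v) a)⁻¹))⁻¹ = a := by
  refine Units.ext ?_
  simp only [map_inv, inv_inv, Units.coe_map, MonoidHom.coe_coe, conjLocal_conjLocal_cm]

/-- `ω` is multiplicative (`E_vˣ` is commutative, `σ` a ring homomorphism). [cite: Rogawski1990, §12.2 p. 173] -/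
theorem reflect₂_mul (a b : (LocalRing L v)ˣ) :
    (Units.map ((conjLocal L (IsCMField.complexConj L) v : LocalRing L v →+* LocalRing L v) : LocalRing L v →* LocalRing L v) (a * b))⁻¹ =
      (Units.map ((conjLocal L (IsCMField.complexConj L) v : LocalRing L v →+* LocalRing L v) : LocalRing L v →* LocalRing L v) a)⁻¹ *
        (Units.map ((conjLocal L (IsCMField.complexConj L) v : LocalRing L v →+* LocalRing L v) : LocalRing L v →* LocalRing L v) b)⁻¹ := by
  rw [map_mul, mul_inv]

/-- **`ω` is a measurable embedding** for the Borel structure (a homeomorphism, being a continuous involution). [cite: Rogawski1990, §12.7 L. 12.7.2 (proof) p. 193] -/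
theorem measurableEmbedding_reflect₂ [MeasurableSpace (LocalRing L v)ˣ] [BorelSpace (LocalRing L v)ˣ] :
    MeasurableEmbedding (fun a : (LocalRing L v)ˣ => (Units.map ((conjLocal L (IsCMField.complexConj L) v : LocalRing L v →+* LocalRing L v) : LocalRing L v →* LocalRing L v) a)⁻¹) :=
  (Homeomorph.mk ⟨(fun a : (LocalRing L v)ˣ => (Units.map ((conjLocal L (IsCMField.complexConj L) v : LocalRing L v →+* LocalRing L v) : LocalRing L v →* LocalRing L v) a)⁻¹),
      (fun a : (LocalRing L v)ˣ => (Units.map ((conjLocal L (IsCMField.complexConj L) v : LocalRing L v →+* LocalRing L v) : LocalRing L v →* LocalRing L v) a)⁻¹),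
      reflect₂_reflect₂ L v, reflect₂_reflect₂ L v⟩ (continuous_reflect₂ L v) (continuous_reflect₂ L v)).measurableEmbedding

/-- `E_vˣ` is locally compact (it is `≃ₜ T₂`, a closed subgroup of the locally compact `G₂`: ★ `torusChartEquiv₂`, ★ `isClosed_cmBorelTriple_M_two`). [cite: Rogawski1990, §12.2 p. 173] -/
theorem locallyCompactSpace_units₂ : LocallyCompactSpace (LocalRing L v)ˣ := by
  haveI : LocallyCompactSpace ↥(unitaryGroupOfForm (conjLocal L (IsCMField.complexConj L) v) (cmLocalForm L 2 v)) :=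
    locallyCompactSpace_local (IsCMField.complexConj L) 2 _ v
  haveI : LocallyCompactSpace ↥(cmBorelTriple L 2 v).M := (K2E3QuasiSplitTwoWeylRadial.isClosed_cmBorelTriple_M_two L v).isClosedEmbedding_subtypeVal.locallyCompactSpace
  exact (torusChartEquiv₂ L v).toHomeomorph.isClosedEmbedding.locallyCompactSpace

/-- The image of a Haar measure on `E_vˣ` under `ω` is a Haar measure (`ω` is a topological-group automorphism). [cite: Rogawski1990, §12.7 L. 12.7.2 (proof) p. 193] -/
theorem isHaarMeasure_map_reflect₂ [MeasurableSpace (LocalRing L v)ˣ] [BorelSpace (LocalRing L v)ˣ] (μ : Measure (LocalRing L v)ˣ) [μ.IsHaarMeasure] :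
    (μ.map (fun a : (LocalRing L v)ˣ => (Units.map ((conjLocal L (IsCMField.complexConj L) v : LocalRing L v →+* LocalRing L v) : LocalRing L v →* LocalRing L v) a)⁻¹)).IsHaarMeasure :=
  ContinuousMulEquiv.isHaarMeasure_map μ
    ({ toFun := (fun a : (LocalRing L v)ˣ => (Units.map ((conjLocal L (IsCMField.complexConj L) v : LocalRing L v →+* LocalRing L v) : LocalRing L v →* LocalRing L v) a)⁻¹)
       invFun := (fun a : (LocalRing L v)ˣ => (Units.map ((conjLocal L (IsCMField.complexConj L) v : LocalRing L v →+* LocalRing L v) : LocalRing L v →* LocalRing L v) a)⁻¹)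
       left_inv := reflect₂_reflect₂ L v
       right_inv := reflect₂_reflect₂ L v
       map_mul' := reflect₂_mul L v
       continuous_toFun := continuous_reflect₂ L v
       continuous_invFun := continuous_reflect₂ L v } : (LocalRing L v)ˣ ≃ₜ* (LocalRing L v)ˣ)

/-- **`ω` PRESERVES EVERY HAAR MEASURE ON `E_vˣ`**: `μ.map ω` is a Haar measure, so `μ.map ω = c • μ` (Haar uniqueness on the second-countable locally compact group
`E_vˣ`); applying `ω` twice gives `μ = c² • μ`, whence `c = 1`.  The N = 2 twin of ★ `F0P3cStCharTSTorusRay.measurePreserving_reflect`.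
[cite: Rogawski1990, §12.7 L. 12.7.2 (proof) p. 193; §12.2 p. 173] -/
theorem measurePreserving_reflect₂ [MeasurableSpace (LocalRing L v)ˣ] [BorelSpace (LocalRing L v)ˣ] (μ : Measure (LocalRing L v)ˣ) [μ.IsHaarMeasure] :
    MeasurePreserving (fun a : (LocalRing L v)ˣ => (Units.map ((conjLocal L (IsCMField.complexConj L) v : LocalRing L v →+* LocalRing L v) : LocalRing L v →* LocalRing L v) a)⁻¹) μ μ := by
  haveI := locallyCompactSpace_units₂ L v
  haveI := F0P3cStCharTSTorusRay.secondCountableTopology_units_localRing L v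
  haveI := isHaarMeasure_map_reflect₂ L v μ
  have hωm : Measurable (fun a : (LocalRing L v)ˣ => (Units.map ((conjLocal L (IsCMField.complexConj L) v : LocalRing L v →+* LocalRing L v) : LocalRing L v →* LocalRing L v) a)⁻¹) :=
    (continuous_reflect₂ L v).measurable
  have hωω : ((fun a : (LocalRing L v)ˣ => (Units.map ((conjLocal L (IsCMField.complexConj L) v : LocalRing L v →+* LocalRing L v) : LocalRing L v →* LocalRing L v) a)⁻¹) ∘
      (fun a : (LocalRing L v)ˣ => (Units.map ((conjLocal L (IsCMField.complexConj L) v : LocalRing L v →+* LocalRing L v) : LocalRing L v →* LocalRing L v) a)⁻¹)) = id := by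
    funext a
    exact reflect₂_reflect₂ L v a
  -- Haar uniqueness: `μ.map ω = c • μ`
  let c : ℝ≥0∞ := (μ.map (fun a : (LocalRing L v)ˣ => (Units.map ((conjLocal L (IsCMField.complexConj L) v : LocalRing L v →+* LocalRing L v) : LocalRing L v →* LocalRing L v) a)⁻¹)).haarScalarFactor μ
  have hc : μ.map (fun a : (LocalRing L v)ˣ => (Units.map ((conjLocal L (IsCMField.complexConj L) v : LocalRing L v →+* LocalRing L v) : LocalRing L v →* LocalRing L v) a)⁻¹) = c • μ :=
    isMulLeftInvariant_eq_smul (μ.map (fun a : (LocalRing L v)ˣ => (Units.map ((conjLocal L (IsCMField.complexConj L) v : LocalRing L v →+* LocalRing L v) : LocalRing L v →* LocalRing L v) a)⁻¹)) μ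
  -- `ω` is an involution, so `μ = c² • μ`
  have h2 : (μ.map (fun a : (LocalRing L v)ˣ => (Units.map ((conjLocal L (IsCMField.complexConj L) v : LocalRing L v →+* LocalRing L v) : LocalRing L v →* LocalRing L v) a)⁻¹)).map
      (fun a : (LocalRing L v)ˣ => (Units.map ((conjLocal L (IsCMField.complexConj L) v : LocalRing L v →+* LocalRing L v) : LocalRing L v →* LocalRing L v) a)⁻¹) = (c ^ 2) • μ := by
    rw [hc, Measure.map_smul, hc, smul_smul, pow_two]
  rw [Measure.map_map hωm hωm, hωω, Measure.map_id] at h2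
  -- evaluate on a compact set with non-empty interior: `c² = 1`, so `c = 1`
  have K : TopologicalSpace.PositiveCompacts (LocalRing L v)ˣ := Classical.arbitrary _
  have hK : c ^ 2 * μ K = 1 ^ 2 * μ K := by
    conv_rhs => rw [h2]
    simp
  have hc2 : c ^ 2 = 1 ^ 2 :=
    (ENNReal.mul_left_inj (measure_pos_of_nonempty_interior _ K.interior_nonempty).ne' K.isCompact.measure_lt_top.ne).1 hK
  have hc1 : c = 1 := (ENNReal.pow_right_strictMono two_ne_zero).injective hc2
  refine ⟨hωm, ?_⟩
  rw [hc, hc1, one_smul]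

/-! ## §2 The fibre dichotomy on `T₂` and the class functions of the hyperbolic set (★ CLS₂ discharged) -/

section Weyl

variable (w₀ : ↥(unitaryGroupOfForm (conjLocal L (IsCMField.complexConj L) v) (cmLocalForm L 2 v)))
  (hw₀ : Units.val (w₀ : GL (Fin 2) (LocalRing L v)) = cmLocalForm L 2 v)

include hw₀ in
/-- **THE FIBRE DICHOTOMY ON `T₂`** (`v` non-split): two REGULAR diagonal elements `t, t′` of `U(Φ₂)(L⁺_v)` that are conjugate in `G₂` are equal or `W`-conjugate:
`t′ = t ∨ t′ = ʷt`.  By ★ Torsor `conj_eq_conj_iff` the conjugator may be taken in `N(T₂)`, and ★ (B4) `N(T₂) = T₂ ⊔ T₂·w₀`; `T₂` is abelian.  The N = 2 twin of ★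
`F0P3cStCharTSWeylHypTorsor.fibre_dichotomy` — the `hdich` letter of ★ CLS₂ `exists_hyperbolicClassFun_two`. [cite: Rogawski1990, §12.5 p. 182] [cite: HarishChandra1970, Lemma 42] -/
theorem eq_or_eq_weylConj_of_isConj₂ (hns : ∀ w : PlacesOver L v, IsCMField.complexConj L • w.1 = w.1) (t t' : ↥(cmBorelTriple L 2 v).M)
    (ht : IsRegularElt (((t : ↥(unitaryGroupOfForm (conjLocal L (IsCMField.complexConj L) v) (cmLocalForm L 2 v))) : GL (Fin 2) (LocalRing L v))))
    (ht' : IsRegularElt (((t' : ↥(unitaryGroupOfForm (conjLocal L (IsCMField.complexConj L) v) (cmLocalForm L 2 v))) : GL (Fin 2) (LocalRing L v))))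
    (hc : IsConj (t : ↥(unitaryGroupOfForm (conjLocal L (IsCMField.complexConj L) v) (cmLocalForm L 2 v))) (t' : ↥(unitaryGroupOfForm (conjLocal L (IsCMField.complexConj L) v) (cmLocalForm L 2 v)))) :
    t' = t ∨ t' = ⟨w₀ * (t : ↥(unitaryGroupOfForm (conjLocal L (IsCMField.complexConj L) v) (cmLocalForm L 2 v))) * w₀⁻¹, UnitaryGroup.weylConj_mem_cmTorus_two L v w₀ hw₀ t⟩ := by
  haveI : Nontrivial (LocalRing L v) := F0P3cStCharTSWeylHypCM.nontrivial_localRing L v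
  have hR : ∀ x : LocalRing L v, x ≠ 0 → IsUnit x := F0P3cStCharTSWeylHypCM.isUnit_of_ne_zero_of_nonsplit L v hns
  obtain ⟨c, hcc⟩ := isConj_iff.1 hc
  -- the conjugator may be taken in the normaliser of `T₂`
  have h1 : c * (t : ↥(unitaryGroupOfForm (conjLocal L (IsCMField.complexConj L) v) (cmLocalForm L 2 v))) * c⁻¹ =
      1 * (t' : ↥(unitaryGroupOfForm (conjLocal L (IsCMField.complexConj L) v) (cmLocalForm L 2 v))) * 1⁻¹ := by rw [hcc, one_mul, inv_one, mul_one]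
  obtain ⟨n, hn, htn, -⟩ := (F0P3cStCharTSWeylHypTorsor.conj_eq_conj_iff (conjLocal L (IsCMField.complexConj L) v) (cmLocalForm L 2 v) t.2 ht t'.2 ht' c 1).1 h1
  have hTcomm := F0P3cStCharTSUpTrU2Norm.forall_mem_torusU_mul_comm (conjLocal L (IsCMField.complexConj L) v) (J := cmLocalForm L 2 v)
  rcases (F0P3cStCharTSUpTrU2Norm.mem_normalizer_torusU_two_iff_mem_or_mul_weyl_mem (conjLocal L (IsCMField.complexConj L) v) hR (cmLocalForm_eq_over L 2 v)
      ⟨t, t.2, ht⟩ hw₀ n).1 hn with hnT | hnw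
  · -- `n ∈ T₂`: `t = n t′ n⁻¹ = t′`
    left
    apply Subtype.ext
    rw [htn, hTcomm n hnT _ t'.2, mul_inv_cancel_right]
  · -- `n w₀ = s ∈ T₂`: `t = s (w₀⁻¹ t′ w₀) s⁻¹`, so `w₀ t w₀⁻¹ = t′`
    right
    apply Subtype.ext
    have hs : n = (n * w₀) * w₀⁻¹ := by rw [mul_inv_cancel_right]
    have hwt : w₀⁻¹ * (t' : ↥(unitaryGroupOfForm (conjLocal L (IsCMField.complexConj L) v) (cmLocalForm L 2 v))) * w₀ ∈ torusU (conjLocal L (IsCMField.complexConj L) v) (cmLocalForm L 2 v) := by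
      -- `w₀⁻¹ t′ w₀ = (n w₀)⁻¹ t (n w₀)` lies in `T₂` (conjugate of `t` by an element of `T₂`… equal to `t`)
      have : w₀⁻¹ * (t' : ↥(unitaryGroupOfForm (conjLocal L (IsCMField.complexConj L) v) (cmLocalForm L 2 v))) * w₀ =
          (n * w₀)⁻¹ * (t : ↥(unitaryGroupOfForm (conjLocal L (IsCMField.complexConj L) v) (cmLocalForm L 2 v))) * (n * w₀) := by
        rw [htn]; group
      rw [this, hTcomm _ (Subgroup.inv_mem _ hnw) _ t.2, inv_mul_cancel_right]
      exact t.2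
    have key : (t : ↥(unitaryGroupOfForm (conjLocal L (IsCMField.complexConj L) v) (cmLocalForm L 2 v))) =
        w₀⁻¹ * (t' : ↥(unitaryGroupOfForm (conjLocal L (IsCMField.complexConj L) v) (cmLocalForm L 2 v))) * w₀ := by
      have e : (t : ↥(unitaryGroupOfForm (conjLocal L (IsCMField.complexConj L) v) (cmLocalForm L 2 v))) =
          (n * w₀) * (w₀⁻¹ * (t' : ↥(unitaryGroupOfForm (conjLocal L (IsCMField.complexConj L) v) (cmLocalForm L 2 v))) * w₀) * (n * w₀)⁻¹ := by
        rw [htn]; group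
      rw [e, hTcomm _ hnw _ hwt, mul_inv_cancel_right]
    show (t' : ↥(unitaryGroupOfForm (conjLocal L (IsCMField.complexConj L) v) (cmLocalForm L 2 v))) =
      w₀ * (t : ↥(unitaryGroupOfForm (conjLocal L (IsCMField.complexConj L) v) (cmLocalForm L 2 v))) * w₀⁻¹
    rw [key]; group

include hw₀ in
/-- **CLASS FUNCTIONS ON THE HYPERBOLIC SET OF `U(Φ₂)(L⁺_v)` FROM `W`-SYMMETRIC TORUS FUNCTIONS** (`v` non-split): for `ψ : T₂ → ℂ` continuous with `ψ(ʷt) = ψ(t)` there is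
`N : G₂ → ℂ` MEASURABLE, CONJUGATION INVARIANT on `Ω₂ = hyperbolicSet₂ L v`, vanishing off `Ω₂`, equal to `ψ` on `T₂^{reg}`, and BOUNDED ON EVERY COMPACT SET — ★ CLS₂
`K2E3HyperbolicClassFunOfTorusTwo.exists_hyperbolicClassFun_two` with its two letters discharged: the fibre dichotomy (§2) and the regular centraliser ★ (A1)
`centralizer_eq_torusU_of_isRegularElt`.  The N = 2 twin of ★ `K2E3HyperbolicClassFunOfTorus.exists_hyperbolicClassFun`.
[cite: Rogawski1990, §12.5 p. 182; §4.9 (4.9.4) p. 56] [cite: HarishChandra1970, Part V §3 Thm. 12; Lemma 42] [cite: vanDijk1972, §2, Thm. p. 237] -/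
theorem exists_hyperbolicClassFun₂ (hns : ∀ w : PlacesOver L v, IsCMField.complexConj L • w.1 = w.1)
    [MeasurableSpace ↥(unitaryGroupOfForm (conjLocal L (IsCMField.complexConj L) v) (cmLocalForm L 2 v))] [BorelSpace ↥(unitaryGroupOfForm (conjLocal L (IsCMField.complexConj L) v) (cmLocalForm L 2 v))]
    (ψ : ↥(cmBorelTriple L 2 v).M → ℂ) (hψ : Continuous ψ)
    (hψw : ∀ t : ↥(cmBorelTriple L 2 v).M,
      ψ ⟨w₀ * (t : ↥(unitaryGroupOfForm (conjLocal L (IsCMField.complexConj L) v) (cmLocalForm L 2 v))) * w₀⁻¹, UnitaryGroup.weylConj_mem_cmTorus_two L v w₀ hw₀ t⟩ = ψ t) :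
    ∃ N : ↥(unitaryGroupOfForm (conjLocal L (IsCMField.complexConj L) v) (cmLocalForm L 2 v)) → ℂ, Measurable N ∧
      (∀ x : ↥(unitaryGroupOfForm (conjLocal L (IsCMField.complexConj L) v) (cmLocalForm L 2 v)), x ∈ hyperbolicSet₂ L v →
        ∀ h : ↥(unitaryGroupOfForm (conjLocal L (IsCMField.complexConj L) v) (cmLocalForm L 2 v)), N (h * x * h⁻¹) = N x) ∧
      (∀ x : ↥(unitaryGroupOfForm (conjLocal L (IsCMField.complexConj L) v) (cmLocalForm L 2 v)), x ∉ hyperbolicSet₂ L v → N x = 0) ∧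
      (∀ t : ↥(cmBorelTriple L 2 v).M,
        IsRegularElt (((t : ↥(unitaryGroupOfForm (conjLocal L (IsCMField.complexConj L) v) (cmLocalForm L 2 v))) : GL (Fin 2) (LocalRing L v))) →
          N (t : ↥(unitaryGroupOfForm (conjLocal L (IsCMField.complexConj L) v) (cmLocalForm L 2 v))) = ψ t) ∧
      (∀ K : Set ↥(unitaryGroupOfForm (conjLocal L (IsCMField.complexConj L) v) (cmLocalForm L 2 v)), IsCompact K → ∃ B : ℝ, ∀ x ∈ K, ‖N x‖ ≤ B) := by
  obtain ⟨N, hNm, hNinv, hN0, hNT, hNbd⟩ := K2E3HyperbolicClassFunOfTorusTwo.exists_hyperbolicClassFun_two L v hns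
    (fun t => ⟨w₀ * (t : ↥(unitaryGroupOfForm (conjLocal L (IsCMField.complexConj L) v) (cmLocalForm L 2 v))) * w₀⁻¹, UnitaryGroup.weylConj_mem_cmTorus_two L v w₀ hw₀ t⟩)
    (fun t t' ht ht' hc => eq_or_eq_weylConj_of_isConj₂ L v w₀ hw₀ hns t t' ht ht' hc)
    (fun t₀ ht₀ => F0P3cStCharTSWeylHypFibre.centralizer_eq_torusU_of_isRegularElt (conjLocal L (IsCMField.complexConj L) v) (cmLocalForm L 2 v) t₀.2 ht₀)
    ψ hψ (fun t _ => hψw t)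
  exact ⟨N, hNm, fun x hx h => hNinv x hx h, fun x hx => hN0 x hx, hNT, hNbd⟩

end Weyl

/-! ## §3 Weighted class functions `α_ψ = dg₂⁻¹ · N_ψ`: measurable, locally integrable, conjugation invariant, `= ψ ∕ Re Δ₂` on `T₂^{reg}` -/

/-- **THE WEIGHTED CLASS FUNCTION OF A `W`-SYMMETRIC TORUS FUNCTION.**  For `ψ : T₂ → ℂ` continuous with `ψ(ʷt) = ψ(t)` there is `α : G₂ → ℂ` (`G₂ = U(Φ₂)(L⁺_v)`, `v`
non-split) which is measurable, LOCALLY INTEGRABLE for every Haar measure (★ HCD₂ `locallyIntegrable_dgFormula₂_inv`: `dg₂⁻¹ ∈ L¹_loc`, and `N_ψ` is bounded on compacts, §2),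
conjugation invariant on `Ω₂`, zero off `Ω₂`, and equal to `(Re Δ₂(t))⁻¹ · ψ(t)` at every regular `t ∈ T₂` (★ A2 junction).  Witness: `α = dg₂⁻¹ · N_ψ`.  The N = 2 twin of ★
`K2E3CharLocIntPrincipalSeriesThree.exists_weightedClassFun`. [cite: Rogawski1990, §12.5 p. 182; §4.9 (4.9.4) p. 56] [cite: HarishChandra1970, Part VII §1 Thm. 15; Lemma 42] -/
theorem exists_weightedClassFun₂ (hns : ∀ w : PlacesOver L v, IsCMField.complexConj L • w.1 = w.1)
    [MeasurableSpace ↥(unitaryGroupOfForm (conjLocal L (IsCMField.complexConj L) v) (cmLocalForm L 2 v))] [BorelSpace ↥(unitaryGroupOfForm (conjLocal L (IsCMField.complexConj L) v) (cmLocalForm L 2 v))]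
    (ν : Measure ↥(unitaryGroupOfForm (conjLocal L (IsCMField.complexConj L) v) (cmLocalForm L 2 v))) [ν.IsHaarMeasure]
    (w₀ : ↥(unitaryGroupOfForm (conjLocal L (IsCMField.complexConj L) v) (cmLocalForm L 2 v))) (hw₀ : Units.val (w₀ : GL (Fin 2) (LocalRing L v)) = cmLocalForm L 2 v)
    (ψ : ↥(cmBorelTriple L 2 v).M → ℂ) (hψ : Continuous ψ)
    (hψw : ∀ t : ↥(cmBorelTriple L 2 v).M,
      ψ ⟨w₀ * (t : ↥(unitaryGroupOfForm (conjLocal L (IsCMField.complexConj L) v) (cmLocalForm L 2 v))) * w₀⁻¹, UnitaryGroup.weylConj_mem_cmTorus_two L v w₀ hw₀ t⟩ = ψ t) :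
    ∃ α : ↥(unitaryGroupOfForm (conjLocal L (IsCMField.complexConj L) v) (cmLocalForm L 2 v)) → ℂ, Measurable α ∧ LocallyIntegrable α ν ∧
      (∀ x : ↥(unitaryGroupOfForm (conjLocal L (IsCMField.complexConj L) v) (cmLocalForm L 2 v)), x ∈ hyperbolicSet₂ L v →
        ∀ h : ↥(unitaryGroupOfForm (conjLocal L (IsCMField.complexConj L) v) (cmLocalForm L 2 v)), α (h * x * h⁻¹) = α x) ∧
      (∀ x : ↥(unitaryGroupOfForm (conjLocal L (IsCMField.complexConj L) v) (cmLocalForm L 2 v)), x ∉ hyperbolicSet₂ L v → α x = 0) ∧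
      (∀ t : ↥(cmBorelTriple L 2 v).M,
        IsRegularElt (((t : ↥(unitaryGroupOfForm (conjLocal L (IsCMField.complexConj L) v) (cmLocalForm L 2 v))) : GL (Fin 2) (LocalRing L v))) →
          α (t : ↥(unitaryGroupOfForm (conjLocal L (IsCMField.complexConj L) v) (cmLocalForm L 2 v))) = ((((vanDijkWeight₂ L v t).re)⁻¹ : ℝ) : ℂ) * ψ t) := by
  haveI : LocallyCompactSpace ↥(unitaryGroupOfForm (conjLocal L (IsCMField.complexConj L) v) (cmLocalForm L 2 v)) := locallyCompactSpace_local (IsCMField.complexConj L) 2 _ v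
  obtain ⟨N, hNm, hNinv, hN0, hNT, hNbd⟩ := exists_hyperbolicClassFun₂ L v w₀ hw₀ hns ψ hψ hψw
  have hϑc : Continuous (dgFormula₂ L v) := K2E3QuasiSplitTwoWeylDensity.continuous_dgFormula₂ L v
  have hϑli : LocallyIntegrable (fun g : ↥(unitaryGroupOfForm (conjLocal L (IsCMField.complexConj L) v) (cmLocalForm L 2 v)) => (dgFormula₂ L v g)⁻¹) ν :=
    K2E3U11WeylDiscrLocInt.locallyIntegrable_dgFormula₂_inv L v hns ν
  refine ⟨fun g => (((dgFormula₂ L v g)⁻¹ : ℝ) : ℂ) * N g, ?_, ?_, ?_, ?_, ?_⟩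
  · exact (Complex.measurable_ofReal.comp hϑc.measurable.inv).mul hNm
  · rw [MeasureTheory.locallyIntegrable_iff]
    intro K hK
    obtain ⟨B, hB⟩ := hNbd K hK
    have hmeas : AEStronglyMeasurable (fun g : ↥(unitaryGroupOfForm (conjLocal L (IsCMField.complexConj L) v) (cmLocalForm L 2 v)) => (((dgFormula₂ L v g)⁻¹ : ℝ) : ℂ) * N g) (ν.restrict K) :=
      ((Complex.measurable_ofReal.comp hϑc.measurable.inv).mul hNm).aestronglyMeasurable
    refine Integrable.mono' (((hϑli.integrableOn_isCompact hK).norm).const_mul (max B 0)) hmeas ?_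
    filter_upwards [ae_restrict_mem hK.measurableSet] with g hg
    rw [norm_mul, Complex.norm_real, mul_comm]
    exact mul_le_mul_of_nonneg_right ((hB g hg).trans (le_max_left _ _)) (norm_nonneg _)
  · intro x hx h
    show (((dgFormula₂ L v (h * x * h⁻¹))⁻¹ : ℝ) : ℂ) * N (h * x * h⁻¹) = (((dgFormula₂ L v x)⁻¹ : ℝ) : ℂ) * N x
    rw [dgFormula₂_conj L v x h, hNinv x hx h]
  · intro x hx
    show (((dgFormula₂ L v x)⁻¹ : ℝ) : ℂ) * N x = 0
    rw [hN0 x hx, mul_zero]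
  · intro t ht
    show (((dgFormula₂ L v (t : ↥(unitaryGroupOfForm (conjLocal L (IsCMField.complexConj L) v) (cmLocalForm L 2 v))))⁻¹ : ℝ) : ℂ) *
        N (t : ↥(unitaryGroupOfForm (conjLocal L (IsCMField.complexConj L) v) (cmLocalForm L 2 v))) = _
    rw [dgFormula₂_coe_torus_eq_vanDijkWeight₂_re L v t, hNT t ht]

end Summit.HodgeConjecture.HodgeConjecture.Cruxes.H413.K2E3QuasiSplitTwoWeightedClassFun

end
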